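/-
Copyright: derived here (Resolution Observatory cell `pub-rosobs`, carver gen 57). AI-written Lean; AI review is weaker than expert
review.  Companion file of the cell's POLYNOMIAL weighted-centre model `W(f)`: the TRIPLE COMPOSITE `Θ = Φ_{l₂σ} ∘ Φ_{l₁σ} ∘ Φ_{l₀σ}`
of engine 1's LEMMA FC, case (B), assembled from the companion files — (B3) `Θ` is a graded isotropy `≡ id (mod σ)` whose pure
vector on a slot of the least pure class has `σ^n`-coefficient `u_n · P(Φ)`, hence vanishes where `u_n = 0`; (B5)–(B6) `Θ = id`
and `u_k` regular for `k ∉ mℕ` force `Φ(C f) ∈ R[ε][σ^m]`; and the Fermat-branch instance `l = (1, t(s), s)` over `K⟦s⟧`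
(THEOREM-FC-eng1-g37 §4 (B1)–(B6)).  The model-level input (B4) "`Θ = id`" is NOT derived here.
Instrument — NOT a resolution theorem and NOT a statement about the invariant of [AbramovichTemkinWlodarczyk2024].
-/
import Literature.AlgebraicGeometry.Resolution.WeightedCentreGradedPureVectors
import Literature.AlgebraicGeometry.Resolution.WeightedCentreSigmaRescaling
import Literature.AlgebraicGeometry.Resolution.WeightedCentreTripleComposite
import Literature.AlgebraicGeometry.Resolution.WeightedCentreFermatBranch
import HarnessLib

/-!
# The triple composite `Θ_l = Φ_{l₂σ} Φ_{l₁σ} Φ_{l₀σ}` of LEMMA FC (B)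

Uniform value line: INSTRUMENT — kernel-checked assembly for the polynomial weighted-centre model `W(f)` of the cell
(engine 1's toy model: THEOREM-FC-eng1-g37 §4 (B)) — NOT a resolution theorem, NOT a statement about the
Abramovich–Temkin–Włodarczyk invariant, NOT summit progress; AI-written Lean, AI review is weaker than expert review.

`R` a commutative ring (cell: `K⟦s⟧`), `Φ` a substitution of `R[ε][σ] = (MvPolynomial ι R)[X]` (ring endomorphism, `Φ σ = σ`,
fixing scalars, `≡ id (mod σ)`), `l = (l₀, l₁, l₂) : Fin 3 → R` scalars, `u_n = Σ_b l_b^n = FermatComposition.powerSum l n`.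
* `theta Φ l := Φ_{l₂σ} ∘ Φ_{l₁σ} ∘ Φ_{l₀σ}` (`rescaleHom` of `WeightedCentreSigmaRescaling`); `Θ σ = σ`, `Θ ≡ id (mod σ)`,
  `Θ` is an isotropy of every `g` of which `Φ` is one, and graded of degree `ρ` if `Φ` is (**(B3) set-up**);
* **(B3) pure vectors** (`Φ` graded, weights `≥ 0`, `ρ > 0`, `Φ` pure-free on the slots lighter than `m*`): `Θ` is pure-free on
  the slots lighter than `m*`, and on a slot `i` of weight `≤ m*`, `P(Θ)_{i,n} = u_n · P(Φ)_{i,n}` (`coeff_pureVec_theta`; three-factor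
  graded CP + `P(Φ_{cσ}) = P(Φ)(cσ)`), `= 0` where `u_n = 0` (`coeff_pureVec_theta_eq_zero`);
* **(B5)–(B6) core** (`R` with `u_k` a non-zero-divisor for `k ∉ mℕ`): `Θ = id ⇒ E_k = 0` for `k ∉ mℕ`
  (`compCoeff_eq_zero_of_theta_eq_id`), i.e. `Φ (C f) = expand m (contract m (Φ (C f))) ∈ R[ε][σ^m]`
  (`map_C_eq_expand_contract_of_theta_eq_id`);
* **the Fermat-branch instance** `R = K⟦s⟧`, `l = (1, t, s)` with `t` a branch (`t^m + (1 + s^m) = 0`, `WeightedCentreFermatBranch`)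
  and `B′ = K[t][s]/(fermat m)` a domain: `u_k ≠ 0` for `k ∉ mℕ` while `u_{m p^e} = 0` in characteristic `p`, so
  `P(Θ)_{i, m p^e} = 0` (`coeff_pureVec_theta_branch_eq_zero`) and `Θ = id ⇒ Φ (C f) ∈ K⟦s⟧[ε][σ^m]`
  (`map_C_eq_expand_contract_of_theta_branch_eq_id`) — LEMMA FC (B) except for the model-level step (B4) `Θ = id`
  (which spends (H1), (H>), (Hmax), LEMMA PR″) and the initial base change `k → K⟦s⟧` (`WeightedCentreSubstBaseChange`).

Pattern cites as in the companion files: [cite: SerreLocalFields1979, Ch. II §4 Lemma 1], [cite: Matsumura1987, §27 (pp. 207–209)],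
[cite: AbramovichTemkinWlodarczyk2024, Thm. 5.3.1 (2)–(3) (p. 1578)].  Formalisation and statements ours, elementary.
-/

namespace Literature.AlgebraicGeometry.Resolution.WeightedBlowup

open Polynomial

section Theta

variable {R : Type*} [CommRing R] {ι : Type*}

/-- `Θ_l := Φ_{l₂σ} ∘ Φ_{l₁σ} ∘ Φ_{l₀σ}` (construction, ours; engine §4 (B3) with `l = (1, t(s), s)` in some order).
[cite: SerreLocalFields1979, Ch. II §4 Lemma 1] -/
noncomputable def theta (Φ : (MvPolynomial ι R)[X] →+* (MvPolynomial ι R)[X]) (l : Fin 3 → R) :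
    (MvPolynomial ι R)[X] →+* (MvPolynomial ι R)[X] :=
  (rescaleHom (MvPolynomial.C (l 2)) Φ).comp ((rescaleHom (MvPolynomial.C (l 1)) Φ).comp (rescaleHom (MvPolynomial.C (l 0)) Φ))

/-- Unfolding (plumbing). [cite: SerreLocalFields1979, Ch. II §4 Lemma 1] -/
theorem theta_def (Φ : (MvPolynomial ι R)[X] →+* (MvPolynomial ι R)[X]) (l : Fin 3 → R) :
    theta Φ l = (rescaleHom (MvPolynomial.C (l 2)) Φ).comp
      ((rescaleHom (MvPolynomial.C (l 1)) Φ).comp (rescaleHom (MvPolynomial.C (l 0)) Φ)) := rfl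

/-- `Θ σ = σ` (plumbing). [cite: SerreLocalFields1979, Ch. II §4 Lemma 1] -/
theorem theta_X (Φ : (MvPolynomial ι R)[X] →+* (MvPolynomial ι R)[X]) (l : Fin 3 → R) : theta Φ l X = X := by
  rw [theta_def, RingHom.comp_apply, RingHom.comp_apply, rescaleHom_X, rescaleHom_X, rescaleHom_X]

/-- `Θ` is an isotropy of every `g` of which `Φ` is one (ours; engine §1 (F2)). [cite: SerreLocalFields1979, Ch. II §4 Lemma 1] -/
theorem isIsotropyOf_theta {g : MvPolynomial ι R} {Φ : (MvPolynomial ι R)[X] →+* (MvPolynomial ι R)[X]} (hΦ : IsIsotropyOf g Φ)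
    (l : Fin 3 → R) : IsIsotropyOf g (theta Φ l) :=
  (isIsotropyOf_rescaleHom hΦ _).comp ((isIsotropyOf_rescaleHom hΦ _).comp (isIsotropyOf_rescaleHom hΦ _))

/-- A ring endomorphism fixing `σ` maps `(σ)` into `(σ)` (plumbing). [cite: SerreLocalFields1979, Ch. II §4 Lemma 1] -/
theorem map_mem_span_X_of_map_X (Γ : (MvPolynomial ι R)[X] →+* (MvPolynomial ι R)[X]) (hX : Γ X = X)
    {f : (MvPolynomial ι R)[X]} (hf : f ∈ Ideal.span {(X : (MvPolynomial ι R)[X])}) :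
    Γ f ∈ Ideal.span {(X : (MvPolynomial ι R)[X])} := by
  obtain ⟨g, rfl⟩ := Ideal.mem_span_singleton'.mp hf
  rw [map_mul, hX]
  exact Ideal.mul_mem_left _ _ (Ideal.mem_span_singleton_self X)

/-- `≡ id (mod σ)` is stable under composition with a map fixing `σ` (plumbing). [cite: SerreLocalFields1979, Ch. II §4 Lemma 1] -/
theorem comp_sub_self_mem (Γ Γ' : (MvPolynomial ι R)[X] →+* (MvPolynomial ι R)[X]) (hX : Γ X = X)
    (hΓ : ∀ f, Γ f - f ∈ Ideal.span {(X : (MvPolynomial ι R)[X])})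
    (hΓ' : ∀ f, Γ' f - f ∈ Ideal.span {(X : (MvPolynomial ι R)[X])}) (f : (MvPolynomial ι R)[X]) :
    (Γ.comp Γ') f - f ∈ Ideal.span {(X : (MvPolynomial ι R)[X])} := by
  rw [RingHom.comp_apply, ← sub_add_sub_cancel _ (Γ f) _, ← map_sub]
  exact add_mem (map_mem_span_X_of_map_X Γ hX (hΓ' f)) (hΓ f)

/-- **`Θ ≡ id (mod σ)`** if `Φ ≡ id (mod σ)` (ours; engine §4 (B3) "Θ ≡ id mod τ"). [cite: SerreLocalFields1979, Ch. II §4 Lemma 1] -/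
theorem theta_sub_self_mem (Φ : (MvPolynomial ι R)[X] →+* (MvPolynomial ι R)[X])
    (hΦ : ∀ f, Φ f - f ∈ Ideal.span {(X : (MvPolynomial ι R)[X])}) (l : Fin 3 → R) (f : (MvPolynomial ι R)[X]) :
    theta Φ l f - f ∈ Ideal.span {(X : (MvPolynomial ι R)[X])} :=
  comp_sub_self_mem _ _ (rescaleHom_X _ Φ) (rescaleHom_sub_self_mem _ Φ hΦ)
    (comp_sub_self_mem _ _ (rescaleHom_X _ Φ) (rescaleHom_sub_self_mem _ Φ hΦ) (rescaleHom_sub_self_mem _ Φ hΦ)) f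

/-! ## (B5)–(B6): `Θ = id` forces `Φ (C f) ∈ R[ε][σ^m]` -/

/-- **LEMMA FC (B5) for `Θ_l`** (ours): `Φ` a substitution (scalars fixed, `≡ id (mod σ)`; `Φ_{cσ} σ = σ` by construction), `Θ_l = id`, and
`u_k = Σ_b l_b^k` a non-zero-divisor of `R[ε]` for every `k ∉ mℕ` ⇒ the component operators `E_k` of `Φ` vanish for `k ∉ mℕ`.
[cite: Matsumura1987, §27 (pp. 207–209)] -/
theorem compCoeff_eq_zero_of_theta_eq_id (Φ : (MvPolynomial ι R)[X] →+* (MvPolynomial ι R)[X])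
    (hC : ∀ r : R, Φ (C (MvPolynomial.C r)) = C (MvPolynomial.C r))
    (hΦ : ∀ f, Φ f - f ∈ Ideal.span {(X : (MvPolynomial ι R)[X])}) (l : Fin 3 → R) (hΘ : theta Φ l = RingHom.id _) {m : ℕ}
    (hu : ∀ k, ¬ m ∣ k → IsSMulRegular (MvPolynomial ι R) (MvPolynomial.C (FermatComposition.powerSum l k) : MvPolynomial ι R)) :
    ∀ k, ¬ m ∣ k → compCoeff Φ k = 0 := by
  refine compCoeff_eq_zero_of_comp_eq_id Φ hΦ (fun b => rescaleHom (MvPolynomial.C (l b)) Φ) (fun b => MvPolynomial.C (l b))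
    (fun b => rescaleHom_X _ Φ) (fun b => hC (l b)) (fun b n a => ?_) hΘ fun k hmk => ?_
  · rw [rescaleHom_C, coeff_sigmaScale]
  · have h : FermatComposition.powerSum (fun b => (MvPolynomial.C (l b) : MvPolynomial ι R)) k =
        MvPolynomial.C (FermatComposition.powerSum l k) := by
      simp only [FermatComposition.powerSum, map_sum, map_pow]
    rw [h]
    exact hu k hmk

/-- **… hence `Φ (C f) ∈ R[ε][σ^m]`** (LEMMA FC (B6) input, ours): `Φ (C f) = expand m (contract m (Φ (C f)))` for `m ≠ 0`.
[cite: Matsumura1987, §27 (pp. 207–209)] -/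
theorem map_C_eq_expand_contract_of_theta_eq_id (Φ : (MvPolynomial ι R)[X] →+* (MvPolynomial ι R)[X])
    (hC : ∀ r : R, Φ (C (MvPolynomial.C r)) = C (MvPolynomial.C r))
    (hΦ : ∀ f, Φ f - f ∈ Ideal.span {(X : (MvPolynomial ι R)[X])}) (l : Fin 3 → R) (hΘ : theta Φ l = RingHom.id _) {m : ℕ}
    (hm : m ≠ 0) (hu : ∀ k, ¬ m ∣ k → IsSMulRegular (MvPolynomial ι R) (MvPolynomial.C (FermatComposition.powerSum l k) : MvPolynomial ι R))
    (f : MvPolynomial ι R) : expand _ m (contract m (Φ (C f))) = Φ (C f) :=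
  expand_contract_of_coeff hm fun n hmn => by
    rw [← compCoeff_apply, compCoeff_eq_zero_of_theta_eq_id Φ hC hΦ l hΘ hu n hmn, AddMonoidHom.zero_apply]

/-- In a domain `R`, `u ≠ 0 ⇒ C u` is a non-zero-divisor of `R[ε]` (plumbing for `hu`). [cite: Lang2002, Ch. IV §1] -/
theorem isSMulRegular_C_of_ne_zero [IsDomain R] {u : R} (hu : u ≠ 0) :
    IsSMulRegular (MvPolynomial ι R) (MvPolynomial.C u : MvPolynomial ι R) := fun a b h => by
  simp only [smul_eq_mul] at h
  exact mul_left_cancel₀ (MvPolynomial.C_ne_zero.mpr hu) h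

end Theta

/-! ## (B3): pure vectors of `Θ` -/

section ThetaGraded

variable {R : Type*} [CommRing R] {ι : Type*} {M : Type*} [AddCommGroup M] [PartialOrder M] [IsOrderedAddMonoid M]
  {w : ι → M} {ρ : M}

omit [PartialOrder M] [IsOrderedAddMonoid M] in
/-- `Θ` is graded of degree `ρ` if `Φ` is (ours; scalars `l_b` have weight `0`).
[cite: AbramovichTemkinWlodarczyk2024, Thm. 5.3.1 (2)–(3) (p. 1578)] -/
theorem isGradedHom_theta {Φ : (MvPolynomial ι R)[X] →+* (MvPolynomial ι R)[X]} (hΦ : IsGradedHom w ρ Φ) (l : Fin 3 → R) :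
    IsGradedHom w ρ (theta Φ l) :=
  (isGradedHom_rescaleHom hΦ _).comp ((isGradedHom_rescaleHom hΦ _).comp (isGradedHom_rescaleHom hΦ _))

/-- **(B3) the pure vector of `Θ` is the sum of the three rescaled pure vectors** on every slot of weight `≤ m*`, when `Φ` is
graded, `≡ id (mod σ)` and pure-free on the slots lighter than `m*` (ours; three-factor graded CP).
[cite: AbramovichTemkinWlodarczyk2024, Thm. 5.3.1 (2)–(3) (p. 1578)] -/
theorem pureVec_theta {Φ : (MvPolynomial ι R)[X] →+* (MvPolynomial ι R)[X]} (hΦ : IsGradedHom w ρ Φ)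
    (hw : ∀ j, 0 ≤ w j) (hρ : 0 < ρ) (hmod : ∀ f, Φ f - f ∈ Ideal.span {(X : (MvPolynomial ι R)[X])}) {m : M}
    (hΦm : ∀ j, w j < m → pureVec Φ j = 0) (l : Fin 3 → R) {i : ι} (hi : w i ≤ m) :
    pureVec (theta Φ l) i = ∑ b, pureVec (rescaleHom (MvPolynomial.C (l b)) Φ) i := by
  rw [theta_def, ← RingHom.comp_assoc,
    (isGradedHom_rescaleHom hΦ _).pureVec_comp_comp (isGradedHom_rescaleHom hΦ _) (isGradedHom_rescaleHom hΦ _)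
      (rescaleHom_X _ Φ) (rescaleHom_X _ Φ) hw hρ (fun i => rescaleHom_sub_self_mem _ Φ hmod _)
      (fun i => rescaleHom_sub_self_mem _ Φ hmod _) (fun j hj => pureVec_rescaleHom_eq_zero _ (hΦm j hj))
      (fun j hj => pureVec_rescaleHom_eq_zero _ (hΦm j hj)) hi,
    Fin.sum_univ_three]
  abel

/-- **(B3) `Θ` is pure-free on the slots lighter than `m*`** (ours). [cite: AbramovichTemkinWlodarczyk2024, Thm. 5.3.1 (2)–(3) (p. 1578)] -/
theorem pureVec_theta_eq_zero {Φ : (MvPolynomial ι R)[X] →+* (MvPolynomial ι R)[X]} (hΦ : IsGradedHom w ρ Φ)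
    (hw : ∀ j, 0 ≤ w j) (hρ : 0 < ρ) (hmod : ∀ f, Φ f - f ∈ Ideal.span {(X : (MvPolynomial ι R)[X])}) {m : M}
    (hΦm : ∀ j, w j < m → pureVec Φ j = 0) (l : Fin 3 → R) {j : ι} (hj : w j < m) : pureVec (theta Φ l) j = 0 := by
  rw [pureVec_theta hΦ hw hρ hmod hΦm l hj.le]
  exact Finset.sum_eq_zero fun b _ => pureVec_rescaleHom_eq_zero _ (hΦm j hj)

/-- **(B3) `P(Θ)_{i,n} = u_n · P(Φ)_{i,n}`** on a slot `i` of weight `≤ m*` (ours; engine: "`= c_a τ^{j*} u_{j*}` on the class `w*`").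
[cite: AbramovichTemkinWlodarczyk2024, Thm. 5.3.1 (2)–(3) (p. 1578)] -/
theorem coeff_pureVec_theta {Φ : (MvPolynomial ι R)[X] →+* (MvPolynomial ι R)[X]} (hΦ : IsGradedHom w ρ Φ)
    (hw : ∀ j, 0 ≤ w j) (hρ : 0 < ρ) (hmod : ∀ f, Φ f - f ∈ Ideal.span {(X : (MvPolynomial ι R)[X])}) {m : M}
    (hΦm : ∀ j, w j < m → pureVec Φ j = 0) (l : Fin 3 → R) {i : ι} (hi : w i ≤ m) (n : ℕ) :
    (pureVec (theta Φ l) i).coeff n = FermatComposition.powerSum l n * (pureVec Φ i).coeff n := by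
  rw [pureVec_theta hΦ hw hρ hmod hΦm l hi, coeff_sum_pureVec_rescaleHom]
  rfl

/-- **(B3) … `= 0` where `u_n = 0`** (ours; cell: `n = j* = m p^e`, `u_{j*} = 0` by Frobenius). So `Θ` HAS NO PURE TERM OF WEIGHT
`≤ w*` when `j*` is the only pure exponent of the class. [cite: AbramovichTemkinWlodarczyk2024, Thm. 5.3.1 (2)–(3) (p. 1578)] -/
theorem coeff_pureVec_theta_eq_zero {Φ : (MvPolynomial ι R)[X] →+* (MvPolynomial ι R)[X]} (hΦ : IsGradedHom w ρ Φ)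
    (hw : ∀ j, 0 ≤ w j) (hρ : 0 < ρ) (hmod : ∀ f, Φ f - f ∈ Ideal.span {(X : (MvPolynomial ι R)[X])}) {m : M}
    (hΦm : ∀ j, w j < m → pureVec Φ j = 0) (l : Fin 3 → R) {i : ι} (hi : w i ≤ m) {n : ℕ}
    (hn : FermatComposition.powerSum l n = 0) : (pureVec (theta Φ l) i).coeff n = 0 := by
  rw [coeff_pureVec_theta hΦ hw hρ hmod hΦm l hi, hn, zero_mul]

end ThetaGraded

/-! ## The Fermat-branch instance `R = K⟦s⟧`, `l = (1, t(s), s)` -/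

section Branch

variable {K : Type*} [Field K] {ι : Type*}

/-- **(B2)+(B5)+(B6) over `K⟦s⟧`** (ours): `t` a branch (`t^m + (1 + s^m) = 0`, `0 < m`), `B′ = K[t][s]/(fermat m)` a domain,
`Φ` a substitution of `K⟦s⟧[ε][σ]` (scalars fixed, `≡ id (mod σ)`) with `Θ_{(1,t,s)} = id` ⇒ `E_k = 0` for every
`k ∉ mℕ`. [cite: Matsumura1987, §27 (pp. 207–209)] -/
theorem compCoeff_eq_zero_of_theta_branch_eq_id {m : ℕ} (hm : 0 < m) {t : PowerSeries K}
    (ht : t ^ m + (1 + PowerSeries.X ^ m) = 0) [IsDomain (AdjoinRoot (FermatComposition.fermat m : K[X][X]))]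
    (Φ : (MvPolynomial ι (PowerSeries K))[X] →+* (MvPolynomial ι (PowerSeries K))[X])
    (hC : ∀ r : PowerSeries K, Φ (C (MvPolynomial.C r)) = C (MvPolynomial.C r))
    (hΦ : ∀ f, Φ f - f ∈ Ideal.span {(X : (MvPolynomial ι (PowerSeries K))[X])})
    (hΘ : theta Φ ![1, t, PowerSeries.X] = RingHom.id _) : ∀ k, ¬ m ∣ k → compCoeff Φ k = 0 :=
  compCoeff_eq_zero_of_theta_eq_id Φ hC hΦ _ hΘ fun k hmk =>
    isSMulRegular_C_of_ne_zero (by rw [FermatBranch.powerSum_eq]; exact FermatBranch.powerSum_ne_zero hm ht hmk)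

/-- **… so `Φ (C f) ∈ K⟦s⟧[ε][σ^m]`** (ours; LEMMA FC (B6) input: with `m ≥ 3` odd this re-grades `Φ` to degree `mρ > ρ`, against (H>)).
[cite: Matsumura1987, §27 (pp. 207–209)] -/
theorem map_C_eq_expand_contract_of_theta_branch_eq_id {m : ℕ} (hm : 0 < m) {t : PowerSeries K}
    (ht : t ^ m + (1 + PowerSeries.X ^ m) = 0) [IsDomain (AdjoinRoot (FermatComposition.fermat m : K[X][X]))]
    (Φ : (MvPolynomial ι (PowerSeries K))[X] →+* (MvPolynomial ι (PowerSeries K))[X])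
    (hC : ∀ r : PowerSeries K, Φ (C (MvPolynomial.C r)) = C (MvPolynomial.C r))
    (hΦ : ∀ f, Φ f - f ∈ Ideal.span {(X : (MvPolynomial ι (PowerSeries K))[X])})
    (hΘ : theta Φ ![1, t, PowerSeries.X] = RingHom.id _) (f : MvPolynomial ι (PowerSeries K)) :
    expand _ m (contract m (Φ (C f))) = Φ (C f) :=
  map_C_eq_expand_contract_of_theta_eq_id Φ hC hΦ _ hΘ hm.ne' (fun k hmk =>
    isSMulRegular_C_of_ne_zero (by rw [FermatBranch.powerSum_eq]; exact FermatBranch.powerSum_ne_zero hm ht hmk)) f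

variable {M : Type*} [AddCommGroup M] [PartialOrder M] [IsOrderedAddMonoid M] {w : ι → M} {ρ : M}

/-- **(B3) over `K⟦s⟧` in characteristic `p`** (ours): for a branch `t` and `Φ` graded, `≡ id (mod σ)`, pure-free below `m*`,
the pure vector of `Θ_{(1,t,s)}` on a slot of weight `≤ m*` has ZERO `σ^{m p^e}`-coefficient (`u_{m p^e} = 0`).
[cite: AbramovichTemkinWlodarczyk2024, Thm. 5.3.1 (2)–(3) (p. 1578)] -/
theorem coeff_pureVec_theta_branch_eq_zero (p : ℕ) [Fact p.Prime] [CharP K p] {m : ℕ} {t : PowerSeries K}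
    (ht : t ^ m + (1 + PowerSeries.X ^ m) = 0) {Φ : (MvPolynomial ι (PowerSeries K))[X] →+* (MvPolynomial ι (PowerSeries K))[X]}
    (hΦ : IsGradedHom w ρ Φ) (hw : ∀ j, 0 ≤ w j) (hρ : 0 < ρ)
    (hmod : ∀ f, Φ f - f ∈ Ideal.span {(X : (MvPolynomial ι (PowerSeries K))[X])}) {mstar : M}
    (hΦm : ∀ j, w j < mstar → pureVec Φ j = 0) {i : ι} (hi : w i ≤ mstar) (e : ℕ) :
    (pureVec (theta Φ ![1, t, PowerSeries.X]) i).coeff (m * p ^ e) = 0 :=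
  coeff_pureVec_theta_eq_zero hΦ hw hρ hmod hΦm _ hi
    (by rw [FermatBranch.powerSum_eq]; exact FermatBranch.powerSum_eq_zero_of_charP p ht e)

end Branch

end Literature.AlgebraicGeometry.Resolution.WeightedBlowup
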